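import Mathlib.Geometry.Manifold.SmoothEmbedding
import Mathlib.Geometry.Manifold.Diffeomorph
import Mathlib.Geometry.Manifold.Instances.Real
import Literature.Geometry.Lorentzian.LorentzianMetric
import Literature.Geometry.Lorentzian.Isometry
import Literature.Geometry.Lorentzian.Causality
import Literature.Geometry.Lorentzian.Einstein
import Literature.Geometry.Lorentzian.Hypersurface
import Literature.Geometry.Lorentzian.InitialData
import HarnessLib

/-!
# Cauchy developments of initial data over the corrected Cauchy-hypersurface notion
(trunk G08 = T-LORENTZ, item C13, repair of `Literature.Geometry.Lorentzian.Development`)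

`Literature.Geometry.Lorentzian.Development` vendors the (globally hyperbolic) developments of an
initial data set `D = (h, k)` on a connected `n`-manifold `X` (Choquet-Bruhat–Geroch 1969;
Ringström 2009, Def. 16.1–16.5) as the structure `Literature.Lorentz.Development D`, whose field
`isCauchySurface : metric.IsCauchySurface timeOrientation (range embed)` uses the misformalised
notion `LorentzianMetric.IsCauchySurface` (it declares every curve with unbounded parameter set
inextendible, so a reparametrised short timelike segment "misses" every candidate surface). That
notion is uninhabited on nonempty carriers (`LorentzianMetric.IsCauchySurface.isEmpty`,
`CausalityProofs`), hence **`Development D` is uninhabited** (`Development.elim`,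
`DevelopmentProofs`) and every fact of the shape `∀ 𝒟 : (Vacuum)Development D, …` — among them the
MGHD-uniqueness clause of Choquet-Bruhat–Geroch and the stability theorems gr.S04–gr.S07 of
`Stability`/`Sweep1` — holds vacuously, while every `∃ 𝒟` fact fails. `Causality` already vendors
the corrected notion `LorentzianMetric.IsCauchyHypersurface` (O'Neill 1983, Ch. 14, Def. 14.28:
"a subset met exactly once by every inextendible timelike curve", with endlessness rendered by
the absence of endpoints, Hawking–Ellis 1973, §6.2). This file carries out the repair announced
in `DevelopmentProofs` (D-0014: new names, the old declarations are untouched):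

* `DataEmbedding D`: a spacetime `(M, g, τ)` of dimension `n + 1` with a smooth embedding
  `ι : X → M`, a future unit normal `ν` along `ι`, `ι^* g = h` and `K_ν = k` — *all fields of
  `Development` except the Cauchy-surface field*. This is what "a solution of the Einstein
  equations with Cauchy data `(X, h, k)`" means before global hyperbolicity is discussed
  (Choquet-Bruhat–Geroch 1969, p. 330, "the data induced on `S`"; Ringström 2009, Def. 16.2
  minus the Cauchy-hypersurface clause), and it is the carrier of *existence* statements such as
  Lindblad–Rodnianski, Ann. of Math. 171 (2010), Thm. 1.1; `DataEmbedding.IsVacuum` (`Ric(g) = 0`).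
* `CauchyDevelopment D extends DataEmbedding D`: moreover `ι(X)` is a Cauchy hypersurface in the
  corrected sense `LorentzianMetric.IsCauchyHypersurface` (Ringström 2009, Def. 16.2–16.3;
  Sbierski 2016, Def. 2.2: "globally hyperbolic development"); `VacuumCauchyDevelopment D`
  adds `Ric(g) = 0`.
* `CauchyDevelopment.EmbedsInto`, `CauchyDevelopment.IsIsometricTo` (Ringström 2009, Def. 16.5;
  Choquet-Bruhat–Geroch 1969, uniqueness clause), `EmbedsInto.refl` and
  `IsIsometricTo.embedsInto` (proved), `CauchyDevelopment.IsMaximalAmong`,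
  `VacuumCauchyDevelopment.IsMaximal` / `IsMGHD` (maximal Cauchy development, MGHD) with
  `isMaximal_iff_isMaximalAmong` (proved), and the forgetful maps to `DataEmbedding`.

The definitions are those of `Development.lean` verbatim (same sign convention
`K_ν(v, w) = + g(D_v ν, dι w)`, same standing hypothesis `[g.HasLeviCivita]` bound innermost in
the `Prop` fields `induced_k`/`isRicciFlat`, same universe discipline: the carrier lives in the
universe of `X` and maximality quantifies over developments in that universe), with the single
change `IsCauchySurface ↦ IsCauchyHypersurface`. Nothing here is deep; the point of the file is
that statements quantified over `CauchyDevelopment D` are no longer vacuous *by construction of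
the structure*: the corrected Cauchy-hypersurface field is satisfied in the basic example —
`{t = 0}` is met exactly once by every endless timelike curve of `(ℝ⁴, η, ∂ₜ)`,
`Minkowski.isCauchyHypersurface_range_sliceEmbed` (`MinkowskiCauchy`, proved from Mathlib
alone) — so that `CauchyDevelopment trivialData` is inhabited by Minkowski spacetime as soon as
the remaining (true) named facts of `ModelData` about the slice `{t = 0}` (smooth embedding,
unit normal `∂ₜ`, induced data `(δ, 0)`, `Ric(η) = 0`) are supplied, exactly as
`Minkowski.development` was meant to be.

## Porting guide (what remains stated over the defective structure)

`Development.HasCompleteFutureNullInfinity` (`NullInfinity`), `HasCompleteFutureNullInfinityFar`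
and gr.S04–gr.S07 (`Stability`, `Sweep1`), `Development.exteriorOf`/`SettlesToKerrFamily`
(`FinalState`), the Choquet-Bruhat–Geroch facts of `CauchyProblem`, `Minkowski.development`
(`ModelData`). Each is to be re-vendored over `CauchyDevelopment` under a new name by its
tenure holder; the existence form of Lindblad–Rodnianski's theorem
(`Literature.GR.lindblad_rodnianski_stability_minkowski_exists`, `Sweep1`) quantifies over the fields
of a `DataEmbedding` directly.

## Mathlib

As for `Development.lean`: Mathlib (at the pin) has `Manifold.IsSmoothEmbedding`, `Diffeomorph`,
`Topology.IsOpenEmbedding`, `ContMDiff`, `𝓡 n`, and no Lorentzian causality, Cauchy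
hypersurfaces or developments.

## References

* Y. Choquet-Bruhat, R. Geroch, *Global aspects of the Cauchy problem in general relativity*,
  Comm. Math. Phys. 14 (1969), 329–335 (developments p. 330; Theorem p. 331).
* H. Ringström, *The Cauchy Problem in General Relativity*, EMS 2009, Ch. 16, Def. 16.1–16.5,
  Thm. 16.6.
* J. Sbierski, *On the existence of a maximal Cauchy development for the Einstein equations: a
  dezornification*, Ann. Henri Poincaré 17 (2016), 301–329, Def. 2.2–2.5, Thm. 2.6.
* B. O'Neill, *Semi-Riemannian geometry with applications to relativity*, Academic Press 1983,
  Ch. 14, Def. 14.28 (Cauchy hypersurface).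
* S. W. Hawking, G. F. R. Ellis, *The large scale structure of space-time*, CUP 1973, §6.2
  (endpoints, inextendible curves), §6.5 (Cauchy developments).
* H. Lindblad, I. Rodnianski, Ann. of Math. 171 (2010), Thm. 1.1 (an existence statement whose
  carrier is a data embedding).
-/

noncomputable section

open Manifold Bundle Set Topology
open scoped ContDiff

universe u

namespace Literature.Geometry.Lorentzian

variable {n : ℕ} {X : Type u} [TopologicalSpace X] [ChartedSpace (EuclideanSpace ℝ (Fin n)) X]
  [IsManifold (𝓡 n) ∞ X]

/-- A **data embedding** of the initial data set `D = (h, k)` on the connected `n`-manifold `X`: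
a spacetime `(M, g, τ)` of dimension `n + 1` (connected, Hausdorff, second countable, smooth
Lorentzian metric, time orientation) with a smooth embedding `ι = embed : X → M`, a future unit
normal field `ν = normal` along `ι`, such that the induced metric is `ι^* g = h` and the second
fundamental form of `ι` w.r.t. `ν` — sign convention `K_ν(v, w) = + g(D_v ν, dι w)`, as for
`D.k` — is `k`. No field equation and no causality condition on `ι(X)` is imposed (see
`DataEmbedding.IsVacuum`, `CauchyDevelopment`). These are the fields of `Development` other
than `isCauchySurface`: "a space-time in which the data are induced on the embedded
hypersurface" (Choquet-Bruhat–Geroch, CMP 14 (1969), p. 330; Ringström 2009, Def. 16.2 without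
the Cauchy-hypersurface clause), the carrier of existence theorems such as Lindblad–Rodnianski,
Ann. of Math. 171 (2010), Thm. 1.1. [cite: ChoquetBruhatGeroch1969CMP, p. 330] -/
structure DataEmbedding [ConnectedSpace X] (D : InitialDataSet (𝓡 n) X)
    extends Spacetime.{u} (n + 1) where
  /-- The embedding `ι : X → M` of the data manifold. -/
  embed : X → carrier
  /-- `ι` is a smooth (`C^∞`) embedding. -/
  isSmoothEmbedding : Manifold.IsSmoothEmbedding (𝓡 n) (𝓡 (n + 1)) ∞ embed
  /-- The future unit normal field `ν` along `ι`. -/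
  normal : NormalField (𝓡 (n + 1)) embed
  /-- `ν` is the future-directed unit (timelike) normal of `ι`. -/
  isFutureUnitNormal : metric.IsFutureUnitNormal (𝓡 n) timeOrientation embed normal
  /-- The induced metric is the data metric: `ι^* g = h`. -/
  induced_h : ∀ y : X,
    pullbackBilin (I := 𝓡 (n + 1)) (I' := 𝓡 n) embed metric.val y = D.h.inner y
  /-- The second fundamental form of `ι` w.r.t. `ν` (Levi-Civita connection of `g`, standing
  hypothesis `[g.HasLeviCivita]`) is the data tensor: `K_ν = k`. -/
  induced_k : ∀ [metric.toPseudoRiemannianMetric.HasLeviCivita] (y : X),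
    metric.toPseudoRiemannianMetric.secondFundamentalForm (𝓡 n) embed normal y = D.kBilin y

namespace DataEmbedding

variable [ConnectedSpace X] {D : InitialDataSet (𝓡 n) X}

/-- The data embedding `𝒮` is **vacuum**: its metric satisfies the Einstein vacuum equations
`Ric(g) = 0` (Ricci tensor of the Levi-Civita connection of `g`, standing hypothesis
`[g.HasLeviCivita]`, bound exactly as in `VacuumDevelopment.isRicciFlat`). Choquet-Bruhat–Geroch,
CMP 14 (1969), p. 330; Ringström 2009, Def. 16.3. [cite: Ringstrom2009, Def. 16.3] -/
def IsVacuum (𝒮 : DataEmbedding D) : Prop :=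
  ∀ [𝒮.metric.toPseudoRiemannianMetric.HasLeviCivita], 𝒮.metric.toPseudoRiemannianMetric.IsRicciFlat

/-- The data embedding `𝒮₁` **embeds into** `𝒮₂` (same data): there is a smooth map
`ψ : M₁ → M₂` which is an open embedding, an isometric immersion `ψ^* g₂ = g₁`, preserves the
time orientations, and satisfies `ψ ∘ ι₁ = ι₂`. Verbatim `Development.EmbedsInto`. Ringström
2009, Def. 16.5; Sbierski 2016, Def. 2.3; Choquet-Bruhat–Geroch 1969, p. 330 ("extension").
[cite: Ringstrom2009, Def. 16.5] -/
def EmbedsInto (𝒮₁ 𝒮₂ : DataEmbedding D) : Prop :=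
  ∃ ψ : 𝒮₁.carrier → 𝒮₂.carrier,
    ContMDiff (𝓡 (n + 1)) (𝓡 (n + 1)) ∞ ψ ∧ IsOpenEmbedding ψ ∧
      𝒮₁.metric.IsIsometricImmersion 𝒮₂.metric.toPseudoRiemannianMetric ψ ∧
      𝒮₁.timeOrientation.PreservesTimeOrientation ψ 𝒮₂.timeOrientation ∧
      ψ ∘ 𝒮₁.embed = 𝒮₂.embed

/-- The data embeddings `𝒮₁`, `𝒮₂` (same data) are **isometric**: there is a smooth
diffeomorphism `ψ : M₁ ≃ M₂` which is an isometry `ψ^* g₂ = g₁`, preserves the time orientations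
and satisfies `ψ ∘ ι₁ = ι₂`. Verbatim `Development.IsIsometricTo`. Choquet-Bruhat–Geroch, CMP 14
(1969), Theorem (p. 331); Ringström 2009, Thm. 16.6; Sbierski 2016, Thm. 2.6.
[cite: Ringstrom2009, Thm. 16.6] -/
def IsIsometricTo (𝒮₁ 𝒮₂ : DataEmbedding D) : Prop :=
  ∃ ψ : Diffeomorph (𝓡 (n + 1)) (𝓡 (n + 1)) 𝒮₁.carrier 𝒮₂.carrier ∞,
    𝒮₁.metric.IsIsometry 𝒮₂.metric.toPseudoRiemannianMetric ψ ∧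
      𝒮₁.timeOrientation.PreservesTimeOrientation ψ 𝒮₂.timeOrientation ∧
      ψ ∘ 𝒮₁.embed = 𝒮₂.embed

/-- Every data embedding embeds into itself (via the identity). Ringström 2009, Def. 16.5.
[cite: Ringstrom2009, Def. 16.5] -/
theorem EmbedsInto.refl (𝒮 : DataEmbedding D) : 𝒮.EmbedsInto 𝒮 := by
  refine ⟨id, contMDiff_id, IsOpenEmbedding.id, ⟨contMDiff_id, fun y ↦ ?_⟩, fun y ↦ ?_, rfl⟩
  · rw [pullbackBilin_id]
  · rw [mfderiv_id]
    exact 𝒮.timeOrientation.isFutureDirected_vectorField y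

/-- Isometric data embeddings embed into each other (the isometry itself is the embedding: a
diffeomorphism is a smooth open embedding, and `ψ^* g₂ = g₁`). Ringström 2009, Def. 16.5.
[cite: Ringstrom2009, Def. 16.5] -/
theorem IsIsometricTo.embedsInto {𝒮₁ 𝒮₂ : DataEmbedding D} (h : 𝒮₁.IsIsometricTo 𝒮₂) :
    𝒮₁.EmbedsInto 𝒮₂ := by
  obtain ⟨ψ, hiso, hτ, hι⟩ := h
  exact ⟨ψ, ψ.contMDiff, ψ.toHomeomorph.isOpenEmbedding, ⟨ψ.contMDiff, hiso⟩, hτ, hι⟩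

end DataEmbedding

/-- A **Cauchy development** (globally hyperbolic development) of the initial data set `D` on the
connected `n`-manifold `X`: a data embedding `(M, g, τ, ι, ν)` of `D` (`DataEmbedding`) whose
image `ι(X)` is a **Cauchy hypersurface** of `(M, g, τ)` in the corrected sense
`LorentzianMetric.IsCauchyHypersurface` (met exactly once by every endless timelike curve;
O'Neill 1983, Ch. 14, Def. 14.28). This is `Development` with its defective field
`isCauchySurface` replaced; no field equations are imposed (see `VacuumCauchyDevelopment`).
Choquet-Bruhat–Geroch, CMP 14 (1969), p. 330 ("development", "S-manifold"); Ringström 2009,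
Def. 16.1–16.3; Sbierski 2016, Def. 2.2. [cite: Ringstrom2009, Def. 16.2] -/
structure CauchyDevelopment [ConnectedSpace X] (D : InitialDataSet (𝓡 n) X)
    extends DataEmbedding D where
  /-- The image `ι(X)` is a Cauchy hypersurface of `(M, g, τ)` (corrected notion). -/
  isCauchyHypersurface : metric.IsCauchyHypersurface timeOrientation (range embed)

/-- A **vacuum Cauchy development** of `D`: a Cauchy development whose metric satisfies the
Einstein vacuum equations `Ric(g) = 0` (standing hypothesis `[g.HasLeviCivita]` bound as in
`VacuumDevelopment.isRicciFlat`). Choquet-Bruhat–Geroch, CMP 14 (1969), p. 330; Ringström 2009,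
Def. 16.3; Sbierski 2016, Def. 2.2. [cite: Ringstrom2009, Def. 16.3] -/
structure VacuumCauchyDevelopment [ConnectedSpace X] (D : InitialDataSet (𝓡 n) X)
    extends CauchyDevelopment D where
  /-- The Einstein vacuum equations `Ric(g) = 0`. -/
  isRicciFlat : ∀ [metric.toPseudoRiemannianMetric.HasLeviCivita],
    metric.toPseudoRiemannianMetric.IsRicciFlat

namespace CauchyDevelopment

variable [ConnectedSpace X] {D : InitialDataSet (𝓡 n) X}

/-- The Cauchy development `𝒟₁` **embeds into** `𝒟₂`: their underlying data embeddings do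
(`DataEmbedding.EmbedsInto`: a smooth, time-orientation preserving, isometric open embedding
`ψ` with `ψ ∘ ι₁ = ι₂`). Ringström 2009, Def. 16.5; Sbierski 2016, Def. 2.3.
[cite: Ringstrom2009, Def. 16.5] -/
abbrev EmbedsInto (𝒟₁ 𝒟₂ : CauchyDevelopment D) : Prop :=
  𝒟₁.toDataEmbedding.EmbedsInto 𝒟₂.toDataEmbedding

/-- The Cauchy developments `𝒟₁`, `𝒟₂` are **isometric as developments**
(`DataEmbedding.IsIsometricTo`). Choquet-Bruhat–Geroch 1969, Theorem (p. 331); Ringström 2009,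
Thm. 16.6. [cite: Ringstrom2009, Thm. 16.6] -/
abbrev IsIsometricTo (𝒟₁ 𝒟₂ : CauchyDevelopment D) : Prop :=
  𝒟₁.toDataEmbedding.IsIsometricTo 𝒟₂.toDataEmbedding

/-- Every Cauchy development embeds into itself. Ringström 2009, Def. 16.5.
[cite: Ringstrom2009, Def. 16.5] -/
theorem EmbedsInto.refl (𝒟 : CauchyDevelopment D) : 𝒟.EmbedsInto 𝒟 :=
  DataEmbedding.EmbedsInto.refl _

/-- Isometric Cauchy developments embed into each other. Ringström 2009, Def. 16.5.
[cite: Ringstrom2009, Def. 16.5] -/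
theorem IsIsometricTo.embedsInto {𝒟₁ 𝒟₂ : CauchyDevelopment D} (h : 𝒟₁.IsIsometricTo 𝒟₂) :
    𝒟₁.EmbedsInto 𝒟₂ :=
  DataEmbedding.IsIsometricTo.embedsInto h

/-- `𝒟` is **maximal among the Cauchy developments satisfying `P`**: `𝒟` satisfies `P` and every
Cauchy development of the same data satisfying `P` embeds into `𝒟` (`P` = vacuum:
`VacuumCauchyDevelopment.IsMaximal`; other matter models take `P` = "solves the coupled field
equations"). Choquet-Bruhat–Geroch, CMP 14 (1969), p. 330; Ringström 2009, Def. 16.5.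
[cite: Ringstrom2009, Def. 16.5] -/
def IsMaximalAmong (P : CauchyDevelopment D → Prop) (𝒟 : CauchyDevelopment D) : Prop :=
  P 𝒟 ∧ ∀ 𝒟' : CauchyDevelopment D, P 𝒟' → 𝒟'.EmbedsInto 𝒟

end CauchyDevelopment

namespace VacuumCauchyDevelopment

variable [ConnectedSpace X] {D : InitialDataSet (𝓡 n) X}

/-- The underlying data embedding of a vacuum Cauchy development is vacuum
(`DataEmbedding.IsVacuum`). Ringström 2009, Def. 16.3. [cite: Ringstrom2009, Def. 16.3] -/
theorem isVacuum (𝒟 : VacuumCauchyDevelopment D) : 𝒟.toDataEmbedding.IsVacuum :=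
  𝒟.isRicciFlat

/-- The vacuum Cauchy development `𝒟` of `D` is **maximal** (a maximal Cauchy development): every
vacuum Cauchy development of the same data (carrier in the same universe) embeds into `𝒟`,
compatibly with the embeddings of `X`. Choquet-Bruhat–Geroch, CMP 14 (1969), Theorem (p. 331);
Ringström 2009, Def. 16.5; Sbierski 2016, Def. 2.5. [cite: Ringstrom2009, Def. 16.5] -/
def IsMaximal (𝒟 : VacuumCauchyDevelopment D) : Prop :=
  ∀ 𝒟' : VacuumCauchyDevelopment.{u} D, 𝒟'.toCauchyDevelopment.EmbedsInto 𝒟.toCauchyDevelopment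

/-- `𝒟` is a **maximal globally hyperbolic (vacuum) development (MGHD)** of `D`: synonym of
`VacuumCauchyDevelopment.IsMaximal`. Choquet-Bruhat–Geroch, CMP 14 (1969); Ringström 2009,
Def. 16.5. [cite: Ringstrom2009, Def. 16.5] -/
abbrev IsMGHD (𝒟 : VacuumCauchyDevelopment D) : Prop :=
  𝒟.IsMaximal

/-- Maximality of a vacuum Cauchy development is maximality among the Ricci-flat Cauchy
developments (`CauchyDevelopment.IsMaximalAmong` with `P 𝒟' := Ric(g') = 0` under the standing
hypothesis `[g'.HasLeviCivita]`). Ringström 2009, Def. 16.5. [cite: Ringstrom2009, Def. 16.5] -/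
theorem isMaximal_iff_isMaximalAmong (𝒟 : VacuumCauchyDevelopment D) :
    𝒟.IsMaximal ↔ 𝒟.toCauchyDevelopment.IsMaximalAmong
      fun 𝒟' ↦ ∀ [𝒟'.metric.toPseudoRiemannianMetric.HasLeviCivita],
        𝒟'.metric.toPseudoRiemannianMetric.IsRicciFlat := by
  constructor
  · intro h
    exact ⟨𝒟.isRicciFlat, fun 𝒟' h' ↦ h ⟨𝒟', h'⟩⟩
  · rintro ⟨-, h⟩ 𝒟'
    exact h 𝒟'.toCauchyDevelopment 𝒟'.isRicciFlat

end VacuumCauchyDevelopment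

end Literature.Geometry.Lorentzian

end
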